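import Literature.MathematicalPhysics.QuantumFieldTheory.BalabanImbrieJaffe1984to88.BIJ88FinalForm313
import Literature.MathematicalPhysics.QuantumFieldTheory.BalabanImbrieJaffe1984to88.BIJ88RTIterated
import Literature.MathematicalPhysics.QuantumFieldTheory.BalabanImbrieJaffe1984to88.BIJ88Scaling313Background

/-!
# `BalabanImbrieJaffe1984to88.BIJ88Scaling313Result` — T. Bałaban, J. Imbrie, A. Jaffe, *Effective action and cluster properties of the
abelian Higgs model*, Commun. Math. Phys. **114** (1988) 257–315 [BalabanImbrieJaffe1988], p. 313 [PDF 57], **THE SCALING (5.15.3) APPLIED TO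
THE RESULT DISPLAY pp. 313–314, AT MEASURE LEVEL.**  The print, verbatim: *"By inserting (5.14.5), (5.15.1), (5.15.2) in (5.12.8), we obtain the
final form of the density ρ^L_{k+1}(v, ψ).  We now scale this density from T_L^{(k+1)} to T₁^{(k+1)}, putting ψ^L(y) = L^{−(d−2)/2}ψ¹(L⁻¹y). If we
define ρ(v, ψ¹) = exp[−((d−2)/2)(log L)|T₁^{(k+1)}|] ρ^L(v, L^{−(d−2)/2}ψ¹), then the integral of ρ(v, ψ¹) is equal to the integral of
ρ^L(v, ψ^L). Thus we define the (k+1)th normalizing energy to be ℰ_{k+1} = ℰ_k + E^{(k)} + ((d−2)/2)(log L)|T₁^{(k+1)}|. (5.15.3)  Let us describe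
how the scaling affects a few of the objects that will be needed in the next step. … The quadratic forms become ½⟨Λ₅^{(k)′**}f^{(k+1)},
σ_{k+1,loc}Λ₅^{(k)′**}f^{(k+1)}⟩ + ½⟨Λ₈^{(k)′}ψ, Δ_{k+1,loc}(u_{k+1})Λ₈^{(k)′}ψ⟩.  The interaction and observables are scaled and written as
𝒫_{k+1,loc}(Λ₈^{(k)}) and F_{k+1,loc}(X_{σ′}), respectively. Propagators and vertices appear scaled to the L⁻¹η lattice. The scaled form of the
normalization factors is given in (4.6), (4.9).  Let {X_{ω′}} be the components of Λ^{(k)c}_{13} … We exhibit the factorization of most of the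
terms in ρ_{k+1}(v, ψ) by writing ρ_{k+1}(v, ψ) = Σ_{{X_{ω′}}} ∫Π_{j=0}^{k} du^{(j)}|_{Λ^{(j)c*}_{10}} ρ′_{k+1}(v, ψ, {X_{ω′}}, {u^{(j)}}), ρ′_{k+1}(…) =
χ_{k+1,Λ^{(k)′}_0} Π_{ω′}g_{k+1}(X_{ω′}) Π_{σ′}F_{k+1,loc}(X_{σ′}) Π_{j=0}^{k}[Z^{(j)}_{Λ^{(j)c*c}_{10}}Z^{(j)}_{Λ^{(j)}_{10}}(u_{k+1})] × exp[−½⟨Λ₅^{(k)′**}f^{(k+1)},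
σ_{k+1,loc}Λ₅^{(k)′**}f^{(k+1)}⟩ − ½⟨Λ₈^{(k)′}ψ, Δ_{k+1,loc}(u_{k+1})Λ₈^{(k)′}ψ⟩ − 𝒫_{k+1,loc}(Λ₈^{(k)}) − ℰ_{k+1}], which is in the form of our
original induction hypothesis, (4.1)."*

statement-level skeleton of published theorems with citation tags; proofs where landed; nothing here is a claim about the Yang–Mills mass gap

WHAT THE TREE HAD.  p34's `BIJ88FinalForm313` types the RESULT display in TESTED form `IsR41T` (for every bounded measurable test `g`:
`∫dvdψ ρ̃ g = Σ_{ω} Σ_{s∈fam ω} ∫dv′∫dψ∫_{Π_{j≤k}𝒟u^{(j)} ⊗ dφ^{(k)}|_{ext}} Y_s(cfg41 r, v′, ψ) g(v_Λ, ψ)`) with the transcribed 8-slot integrand `ρ′_{k+1}`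
(`Result313`, `rhoPrime313`, `IsResult313`), proved from (5.12.8) — BEFORE the scaling: *"the scaling (5.15.3) is not applied here (rows
C2.Eq5.15.3, r16/p31)"* (its header).  r16/p34's `BIJ88RTIterated.scaleStep c ρ (v, ψ¹) := c^{dim_ℝ ℂ^{T}} ρ(v, cψ¹)` is the scaling `𝒮` with the
HONEST Jacobian `c^{2|T|}` (`integral_scaleStep`: *"the integral of ρ(v, ψ¹) is equal to the integral of ρ^L(v, ψ^L)"*; `scaleJac_eq_exp_neg_E0prime`:
for the printed `c = L^{−(d−2)/2}` the Jacobian is `exp(−E′)`, `E′ = (d−2)(log L)|T₁|` = r18's (3.42) `E0prime`; the printed `(d−2)/2` of (5.15.3)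
is the located slip HOME/GAPS.md G-C2-10, kernel witness `scaleJac_ne_printed5153`).  In the `Setup` tower the sites of `T_L^{(k+1)}` and `T₁^{(k+1)}`
are one type, so the lattice relabelling `y ↦ L⁻¹y` is bookkeeping of spacings ((2.12): *"Superscripts L^jη, η, etc. indicate the lattice
spacing for operators rescaled to nonstandard lattices"*) and `𝒮` acts on the block scalar field only; the block gauge field `v` is untouched.

WHAT IS PROVED HERE (theorems + one def with body; 0 `sorry`; no `Prop`-valued fact; standard axioms).
* §1 **`isR41T_scaleStep`** (and `isDF_scaleStep` for the final form of p. 313): if `ρ^L_{k+1}` satisfies the tested (4.1)-form display with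
  brackets `Y_s`, then `𝒮_cρ^L_{k+1} = scaleStep c ρ^L_{k+1}` satisfies THE SAME display with the brackets `Y′_s(q, v, ψ¹) := c^{2|T|}·Y_s(q, v, cψ¹)`
  — every `c > 0`, every density, no integrability needed: the substitution `ψ = cψ¹` is performed INSIDE the test (p34 gen 1's
  `BIJ88Sect3Rescaling.integral_comp_smul_jac`, Mathlib's `Measure.integral_comp_smul`), once on the left member with the test `g(v, c⁻¹ψ)` and
  once back in every term.  This is the sentence *"We now scale this density from T_L^{(k+1)} to T₁^{(k+1)}"* for the RESULT display: the outer
  structure `Σ_{{X_{ω′}}} ∫Π_{j=0}^{k}du^{(j)} …` survives the scaling unchanged, only the integrand is rescaled.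
* §2 **`scaledTable c E′ R`** (def with body): p34's table `Result313` with every slot read at `ψ = cψ¹` and the energy slot shifted by `E′`;
  **`rhoPrime313_scaled`**: `c^{2|T|}·ρ′_{k+1}[R](q, v, cψ¹) = ρ′_{k+1}[scaledTable c E′ R](q, v, ψ¹)` with `E′ = −2|T| log c` — the Jacobian is
  ABSORBED INTO THE NORMALIZING ENERGY, *"Thus we define the (k+1)th normalizing energy to be ℰ_{k+1} = ℰ_k + E^{(k)} + …"*: the `ℰ`-slot of the
  scaled table is the old one plus `E′` (`scaledTable_calE`), and for the printed `c` this `E′` is `E0prime d L |T₁^{(k+1)}|` (`jacExponent_printed`).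
* §3 **`isResult313_scaleStep`**: `IsResult313 R holes fam Λ Qu D hole ρ^L_{k+1} → IsResult313 (scaledTable c (−2|T|log c) R) holes fam Λ Qu D hole
  (scaleStep c ρ^L_{k+1})` — THE RESULT DISPLAY AFTER THE SCALING, *"which is in the form of our original induction hypothesis, (4.1)"*, with the
  printed instance **`isResult313_scaleStep_printed`** (`c = L^{−(d−2)/2}`, `ℰ`-slot `+ E0prime P.d L |T₁^{(k+1)}|`: ℰ_{k+1} = ℰ_k + E^{(k)} + E^{(k)′}
  with the honest `E^{(k)′} = (d−2)(log L)|T₁^{(k+1)}|`), and the total integral preserved (`integral_scaleStep_result`, r16/p34's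
  `integral_integral_scaleStep` BY NAME).
* §4 THE THREE PROSE SENTENCES OF p. 313 AS SLOT THEOREMS on the scaled table: *"The quadratic forms become …"* — `scaledTable_quadPsi` (the
  `ψ`-form slot of the scaled table IS the old slot at `cψ¹`) with **`quadForm_scale`** (for a slot given by a restriction `S` and an operator
  `A` on a real inner-product space, `⟨S(cψ¹), A S(cψ¹)⟩ = ⟨Sψ¹, (c²A)Sψ¹⟩`: the form of `ψ¹` is the form of the RESCALED operator
  `c²·Δ^L_{k+1,loc}(u_{k+1})`, which (2.12) names `Δ_{k+1,loc}(u_{k+1})`), `scaledTable_quadF` with **`quadForm_renaming`** (the `f`-form is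
  unchanged as a function of `v`; renaming `f = r·f^{(k+1)}`, `r = e_{k+1}/e_k` — this seat's gen-9 `BIJ88Scaling313Background.fieldStrength_units`
  `e_kf = e_{k+1}f^{(k+1)}` — turns `⟨Λ₅f, σ^L Λ₅f⟩` into `⟨Λ₅f^{(k+1)}, (r²σ^L)Λ₅f^{(k+1)}⟩`, the operator (2.12) names `σ_{k+1,loc}`);
  *"The interaction and observables are scaled and written as 𝒫_{k+1,loc}(Λ₈^{(k)}) and F_{k+1,loc}(X_{σ′})"* — `scaledTable_Ploc`,
  `scaledTable_obs` (definitions by composition with `ψ ↦ cψ¹`); *"The scaled form of the normalization factors is given in (4.6), (4.9)"* —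
  `scaledTable_zf` (the `Z`-slot composed; its `k`-independence under the (2.12) rescaling of the precisions is r18's `BIJ88Eq47Scaling.Z46_Ekv_of_smul`
  / `BIJ88Eq411Scaling`, rows C2.Eq4.7/4.11, not repeated); the characteristic function and the hole functionals likewise (`scaledTable_chi`,
  `scaledTable_holeF`: (4.5) and (5.15.4) read in `ψ¹`).
* §6 (v1.1, append-only) **the two quadratic forms in the KERNEL vocabulary of r18's (4.1)** (`BIJ88InductiveForm41.gaugeForm`/`scalarForm`/
  `fStrength`): `fStrength_units`/`fStrength_rescale` (e·f_e = e′·f_{e′}, from this seat's gen-9 `BIJ88Scaling313Background.fieldStrength_units`),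
  **`gaugeForm_rescale`** (the (4.1) gauge form of a `Term41` at charge `e_k` with kernel `σ^L` IS the gauge form at charge `e_{k+1}` with kernel
  `(e_{k+1}/e_k)²σ^L` — *"½⟨Λ₅f, σ^L Λ₅f⟩"* = *"½⟨Λ₅f^{(k+1)}, σ_{k+1,loc}Λ₅f^{(k+1)}⟩"*), **`scalarForm_rescale`** (the (4.1) scalar form at `ψ^L = cψ¹` with kernel
  `Δ^L` IS the scalar form at `ψ¹` with kernel `c²Δ^L` — *"½⟨Λ₈′ψ, Δ_{k+1,loc}(u_{k+1})Λ₈′ψ⟩"*): the renamed kernels ARE `Term41` kernels at `k+1`.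
* §5 `scaleStep_congr_ae`: `𝒮_c` respects `dv dψ`-a.e. equality (the substitution map is quasi-measure-preserving, `map_prod_smul_psi`), so the
  scaling may be read on p34's FUNCTION identities for the density (`BIJ88Eq596FibreIntegral.result41_ae_eq`) as well as on the tested display.
HONEST SCOPE.  (i) The slots are p34's abstract slot functions; this file performs the scaling on them and on the display, it does not construct
`σ_{k+1,loc}`, `Δ_{k+1,loc}(u_{k+1})`, `𝒫_{k+1,loc}`, `F_{k+1,loc}` natively at step `k+1` (rows C2.Eq2.14, C2.Eq2.34, (4.1) at `k+1`): that the
rescaled objects coincide with the natively defined ones is the (2.12) CONVENTION (*"operators rescaled to nonstandard lattices"*), recorded in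
the slot lemmas, exactly as in r18's `BIJ88Eq47Scaling` (precision `× ξ^{d−2}` displayed) and this seat's `BIJ88Scaling313Background` (`hD`).
(ii) *"Propagators and vertices appear scaled to the L⁻¹η lattice"* is the same convention inside `𝒫_{k+1,loc}` (slot `Ploc` composed); no kernel
is rescaled here.  (iii) No bound; no factorization of the hole functionals (p34's `BIJ88HoleProduct5154`); nothing of B1–B16; NOT summit
progress; NOT continuum; NOT Clay.
CITATION HEADER (lean-in-tree rule).  Part of the lit-balaban TYPED SKELETON (HOME `run/shared/lean/pub/lit-balaban/`), PHASE-2 proof seat p31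
gen 13 (unit `lit-balaban-p31-g13`; TAKING line HOME/STATUS.md 2026-08-22T07:15Z, free-target protocol G.5-34(d), own lane = the p. 313 scaling
paragraph, continuation of gen 9's `BIJ88Scaling313Background` p305240).  Rows served: **`C2.Eq5.15.3`** (the scaling paragraph: its three prose
sentences, owner r16 `HOME/lit-balaban-r16/ROWS-C2-part2.md`: *"NOT typed … (prose, definitions by renaming)"*) and **`C2.Claim@313`** member (the
RESULT display after the scaling).  PDF held: `paper:balaban1988-cmp114-bij-abelian-higgs-effective-action` (journal page = PDF page + 256);
p. 313 [PDF 57] re-read this session as an image (`HOME/lit-balaban-r16/renders/cmp114/original-p057-x2.png`), p. 261 [PDF 5] for (2.12).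
Imports p34's `BIJ88FinalForm313`, r16/p34's `BIJ88RTIterated` and (v1.1) this seat's `BIJ88Scaling313Background` (Literature + Mathlib);
sub-namespace `…BIJ88Scaling313Result`; nothing
re-declared, nothing restated.
-/

namespace Literature.MathematicalPhysics.QuantumFieldTheory.BalabanImbrieJaffe1984to88.BIJ88Scaling313Result

open Literature.MathematicalPhysics.QuantumFieldTheory.Balaban1983to89
open BIJ88Sect3Statements (U1 E0prime)
open BIJ85Sect1Model (HiggsField)
open BIJ88InductiveForm41 (Prev prevMeasure)
open BIJ88Eq596Display (vCut)
open BIJ88Eq5128Split (Cfg Interior)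
open BIJ88FinalForm313 (IsDF IsR41T Result313 rhoPrime313 IsResult313 isResult313_iff isResult313_of_isR41T cfg41)
open BIJ88RTIterated (scaleStep integral_scaleStep integral_integral_scaleStep)
open BIJ88Sect3Rescaling (integral_comp_smul_jac finrank_higgsField)
open scoped BigOperators ENNReal RealInnerProductSpace
open _root_.MeasureTheory _root_.MeasureTheory.Measure Function Set

noncomputable section

variable {P : Params} {k : ℕ}

/-! ## §0 The Jacobian of `ψ = cψ¹` and its exponent -/

section Jacobian

/-- The real dimension `N = dim_ℝ ℂ^{T₁^{(k+1)}} = 2|T₁^{(k+1)}|` of the block scalar field space, the exponent of the Jacobian `c^N` of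
`ψ^L = cψ¹` (p34 gen 1's `finrank_higgsField`). [cite: BalabanImbrieJaffe1988, (5.15.3) p.313] -/
abbrev dimPsi (P : Params) (k : ℕ) : ℕ := Module.finrank ℝ (HiggsField P (k+1))

/-- kernel: `N = 2|T₁^{(k+1)}|`. [cite: BalabanImbrieJaffe1988, (5.15.3) p.313] -/
theorem dimPsi_eq : dimPsi P k = 2 * Fintype.card (Balaban1983to89.Site P (k+1)) :=
  finrank_higgsField

/-- **The exponent absorbed into the normalizing energy**: for `c > 0` the Jacobian is `c^N = exp(−E′)` with `E′ = −N log c`.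
[cite: BalabanImbrieJaffe1988, (5.15.3) p.313] -/
theorem jac_eq_exp {c : ℝ} (hc : 0 < c) (N : ℕ) : c ^ N = Real.exp (-(-(N * Real.log c))) := by
  rw [neg_neg, Real.exp_nat_mul, Real.exp_log hc]

/-- **The printed instance**: for `c = L^{−(d−2)/2}` and `N = 2|T₁|`, `E′ = −N log c = (d−2)(log L)|T₁| = E0prime d L |T₁|` — r18's (3.42)
`E^{(0)′}` at level `k+1`, the HONEST increment of the normalizing energy (the printed `(d−2)/2` of (5.15.3) is the located slip G-C2-10;
r16/p34's `scaleJac_ne_printed5153`; the Jacobian itself, `(L^{−(d−2)/2})^{2n} = exp(−E0prime d L n)`, is their `scaleJac_eq_exp_neg_E0prime`,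
not restated). [cite: BalabanImbrieJaffe1988, (5.15.3) p.313] -/
theorem jacExponent_printed {L : ℝ} (hL : 0 < L) (d n : ℕ) :
    -((2 * n : ℕ) * Real.log (L ^ (-(((d : ℝ) - 2) / 2)))) = E0prime d L n := by
  rw [Real.log_rpow hL, E0prime]
  push_cast
  ring

end Jacobian

/-! ## §1 The tested displays under the scaling of the block scalar field -/

section Displays

variable {ι Ω : Type*}

/-- kernel: **the substitution `ψ = cψ¹` inside one term of a tested display** — for any inner measure `μ` and any term bracket `Y` and
test factor `G`, `∫dψ ∫μ(da) Y(a, ψ) G(a, c⁻¹ψ) = ∫dψ¹ ∫μ(da) [c^N Y(a, cψ¹)] G(a, ψ¹)` (Lebesgue measure on `ℂ^{T}` scales by `c^N`;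
no integrability needed). [cite: BalabanImbrieJaffe1988, (5.15.3) p.313] -/
theorem integral_integral_subst_scale {α : Type*} [MeasurableSpace α] (μ : Measure α) {c : ℝ} (hc : 0 < c)
    (Y G : α → HiggsField P (k+1) → ℂ) :
    ∫ ψ, ∫ a, Y a ψ * G a (c⁻¹ • ψ) ∂μ = ∫ ψ, ∫ a, ((c ^ dimPsi P k : ℝ) : ℂ) * Y a (c • ψ) * G a ψ ∂μ := by
  rw [integral_comp_smul_jac (fun ψ => ∫ a, Y a ψ * G a (c⁻¹ • ψ) ∂μ) hc]
  refine integral_congr_ae (Filter.Eventually.of_forall fun ψ => ?_)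
  simp only [inv_smul_smul₀ hc.ne', Complex.real_smul]
  rw [← integral_const_mul]
  refine integral_congr_ae (Filter.Eventually.of_forall fun a => ?_)
  simp only [dimPsi]
  ring

/-- kernel: **the left member** — `∫dψ¹ (𝒮_cρ)(v, ψ¹) g(v, ψ¹) = ∫dψ ρ(v, ψ) g(v, c⁻¹ψ)` (the scaled density tested by `g` is the density tested
by `g ∘ (v, c⁻¹·)`). [cite: BalabanImbrieJaffe1988, (5.15.3) p.313] -/
theorem integral_scaleStep_mul_test {c : ℝ} (hc : 0 < c) (ρL : GaugeField P (k+1) U1 → HiggsField P (k+1) → ℂ)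
    (g : GaugeField P (k+1) U1 × HiggsField P (k+1) → ℂ) (v : GaugeField P (k+1) U1) :
    ∫ ψ, scaleStep c ρL v ψ * g (v, ψ) = ∫ ψ, ρL v ψ * g (v, c⁻¹ • ψ) := by
  rw [integral_comp_smul_jac (fun ψ => ρL v ψ * g (v, c⁻¹ • ψ)) hc]
  refine integral_congr_ae (Filter.Eventually.of_forall fun ψ => ?_)
  simp only [scaleStep, inv_smul_smul₀ hc.ne', Complex.real_smul]
  ring

/-- kernel: the rescaled test `(v, ψ) ↦ g(v, c⁻¹ψ)` is measurable and bounded with `g`. [cite: BalabanImbrieJaffe1988, (5.15.3) p.313] -/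
theorem test_rescaled (c : ℝ) {g : GaugeField P (k+1) U1 × HiggsField P (k+1) → ℂ} (hg : Measurable g) (hb : ∃ C : ℝ, ∀ z, ‖g z‖ ≤ C) :
    Measurable (fun z : GaugeField P (k+1) U1 × HiggsField P (k+1) => g (z.1, c⁻¹ • z.2)) ∧
      ∃ C : ℝ, ∀ z : GaugeField P (k+1) U1 × HiggsField P (k+1), ‖g (z.1, c⁻¹ • z.2)‖ ≤ C :=
  ⟨hg.comp (measurable_fst.prodMk ((measurable_const_smul c⁻¹).comp measurable_snd)), hb.imp fun _ hC z => hC (z.1, c⁻¹ • z.2)⟩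

variable {holes : Finset Ω} {fam : Ω → Finset ι} {terms : Finset ι} {Λ : ι → Finset (PBond P (k+1))}
variable {Qu : GaugeField P k U1 → GaugeField P (k+1) U1} {D : ι → Interior P k} {ext : ι → Measure (Cfg P k)}
variable {Y : ι → Cfg P k → GaugeField P (k+1) U1 → HiggsField P (k+1) → ℂ} {ρL : GaugeField P (k+1) U1 → HiggsField P (k+1) → ℂ}

/-- **THE RESULT DISPLAY UNDER THE SCALING (5.15.3)** — *"We now scale this density from T_L^{(k+1)} to T₁^{(k+1)}, putting ψ^L(y) =
L^{−(d−2)/2}ψ¹(L⁻¹y)"*: if `ρ^L_{k+1}` has the tested (4.1)-form display `Σ_{{X_{ω′}}} ∫Π_{j=0}^{k}du^{(j)} … ρ′_{k+1}` with brackets `Y_s`, then the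
scaled density `𝒮_cρ^L_{k+1}` (r16/p34's `scaleStep`, honest Jacobian `c^N`) has the same display with the brackets read at `ψ = cψ¹` and multiplied
by the Jacobian, `Y′_s(q, v, ψ¹) = c^N·Y_s(q, v, cψ¹)` — every `c > 0`. [cite: BalabanImbrieJaffe1988, (5.15.3) p.313] -/
theorem isR41T_scaleStep {c : ℝ} (hc : 0 < c) (h : IsR41T holes fam Λ Qu D Y ρL) :
    IsR41T holes fam Λ Qu D (fun s q v ψ => ((c ^ dimPsi P k : ℝ) : ℂ) * Y s q v (c • ψ)) (scaleStep c ρL) := by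
  intro g hg hb
  obtain ⟨hg', hb'⟩ := test_rescaled c hg hb
  have lhs : (fun v => ∫ ψ, scaleStep c ρL v ψ * g (v, ψ)) =
      fun v => ∫ ψ, ρL v ψ * (fun z : GaugeField P (k+1) U1 × HiggsField P (k+1) => g (z.1, c⁻¹ • z.2)) (v, ψ) :=
    funext fun v => integral_scaleStep_mul_test hc ρL g v
  rw [lhs, h _ hg' hb']
  refine Finset.sum_congr rfl fun ω _ => Finset.sum_congr rfl fun s _ => ?_
  refine integral_congr_ae (Filter.Eventually.of_forall fun v' => ?_)
  exact integral_integral_subst_scale _ hc (fun r ψ => Y s (cfg41 (D s) r) v' ψ)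
    (fun r ψ => g (vCut Qu (Λ s) (cfg41 (D s) r).1 v', ψ))

/-- **The final form of p. 313 under the scaling** (p34's exterior-only display `IsDF`, the shape *"By inserting (5.14.5), (5.15.1), (5.15.2) in
(5.12.8), we obtain the final form of the density ρ^L_{k+1}(v, ψ)"*): the same statement for the display over the exterior measures `ext_s`.
[cite: BalabanImbrieJaffe1988, (5.15.3) p.313] -/
theorem isDF_scaleStep {c : ℝ} (hc : 0 < c) (h : IsDF terms Λ Qu ext Y ρL) :
    IsDF terms Λ Qu ext (fun s q v ψ => ((c ^ dimPsi P k : ℝ) : ℂ) * Y s q v (c • ψ)) (scaleStep c ρL) := by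
  intro g hg hb
  obtain ⟨hg', hb'⟩ := test_rescaled c hg hb
  have lhs : (fun v => ∫ ψ, scaleStep c ρL v ψ * g (v, ψ)) =
      fun v => ∫ ψ, ρL v ψ * (fun z : GaugeField P (k+1) U1 × HiggsField P (k+1) => g (z.1, c⁻¹ • z.2)) (v, ψ) :=
    funext fun v => integral_scaleStep_mul_test hc ρL g v
  rw [lhs, h _ hg' hb']
  refine Finset.sum_congr rfl fun s _ => ?_
  refine integral_congr_ae (Filter.Eventually.of_forall fun v' => ?_)
  exact integral_integral_subst_scale _ hc (fun q ψ => Y s q v' ψ) (fun q ψ => g (vCut Qu (Λ s) q.1 v', ψ))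

/-- **p. 313, *"then the integral of ρ(v, ψ¹) is equal to the integral of ρ^L(v, ψ^L)"*, for a density with the RESULT display**: the total
integral is preserved (r16/p34's `integral_integral_scaleStep` BY NAME; recorded here next to the display it accompanies).
[cite: BalabanImbrieJaffe1988, (5.15.3) p.313] -/
theorem integral_scaleStep_result {c : ℝ} (hc : 0 < c) (ρL : GaugeField P (k+1) U1 → HiggsField P (k+1) → ℂ) :
    ∫ v, ∫ ψ, scaleStep c ρL v ψ ∂volume ∂fieldMeasure P (k+1) U1 = ∫ v, ∫ ψ, ρL v ψ ∂volume ∂fieldMeasure P (k+1) U1 :=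
  integral_integral_scaleStep hc ρL

end Displays

/-! ## §2 The scaled table: the slots of `ρ′_{k+1}` read at `ψ = cψ¹`, the Jacobian absorbed into `ℰ_{k+1}` -/

section Table

variable {Ω : Type*}

/-- **THE SLOT TABLE OF THE RESULT AFTER THE SCALING** — p34's transcription `Result313` of `ρ′_{k+1}` with every slot read at `ψ^L = cψ¹` (*"The
quadratic forms become … The interaction and observables are scaled and written as 𝒫_{k+1,loc}(Λ₈^{(k)}) and F_{k+1,loc}(X_{σ′}) … The scaled
form of the normalization factors is given in (4.6), (4.9)"*) and the normalizing-energy slot shifted by the Jacobian exponent `E′` (*"Thus we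
define the (k+1)th normalizing energy to be ℰ_{k+1} = ℰ_k + E^{(k)} + …"*). [cite: BalabanImbrieJaffe1988, (5.15.3) p.313] -/
def scaledTable (c E' : ℝ) (R : Result313 P k Ω) : Result313 P k Ω where
  chi ω q v ψ := R.chi ω q v (c • ψ)
  holeF ω q v ψ := R.holeF ω q v (c • ψ)
  obs ω q v ψ := R.obs ω q v (c • ψ)
  zf ω q v ψ := R.zf ω q v (c • ψ)
  quadF ω q v ψ := R.quadF ω q v (c • ψ)
  quadPsi ω q v ψ := R.quadPsi ω q v (c • ψ)
  Ploc ω q v ψ := R.Ploc ω q v (c • ψ)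
  calE ω q v ψ := R.calE ω q v (c • ψ) + E'

variable (c E' : ℝ) (R : Result313 P k Ω) (ω : Ω) (q : Cfg P k) (v : GaugeField P (k+1) U1) (ψ : HiggsField P (k+1))

/-- *"The quadratic forms become … ½⟨Λ₈^{(k)′}ψ, Δ_{k+1,loc}(u_{k+1})Λ₈^{(k)′}ψ⟩"* — the `ψ`-form slot of the scaled table is the slot
`⟨Λ₈^{(k)′}ψ^L, Δ^L_{k+1,loc}(u_{k+1})Λ₈^{(k)′}ψ^L⟩` of (5.8.3)/(5.12.8) read at `ψ^L = cψ¹`; by `quadForm_scale` below this is the form of `ψ¹` with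
the rescaled operator `c²Δ^L_{k+1,loc}(u_{k+1})`, the one (2.12) names `Δ_{k+1,loc}(u_{k+1})`. [cite: BalabanImbrieJaffe1988, (5.15.3) p.313] -/
theorem scaledTable_quadPsi : (scaledTable c E' R).quadPsi ω q v ψ = R.quadPsi ω q v (c • ψ) := rfl

/-- *"The quadratic forms become ½⟨Λ₅^{(k)′**}f^{(k+1)}, σ_{k+1,loc}Λ₅^{(k)′**}f^{(k+1)}⟩ + …"* — the `f`-form slot: the scaling does not touch
the block gauge field `v`, so the slot `⟨Λ₅^{(k)′**}f, σ^L_{k+1,loc}Λ₅^{(k)′**}f⟩` (`f = (ie_k)⁻¹log v`) is carried over as a function of the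
configuration; its printed form in `f^{(k+1)} = (ie_{k+1})⁻¹log v` is the renaming `quadForm_renaming` below (`e_kf = e_{k+1}f^{(k+1)}`: this
seat's `BIJ88Scaling313Background.fieldStrength_units`), the operator `(e_{k+1}/e_k)²σ^L_{k+1,loc}` being the one (2.12) names `σ_{k+1,loc}`.
[cite: BalabanImbrieJaffe1988, (5.15.3) p.313] -/
theorem scaledTable_quadF : (scaledTable c E' R).quadF ω q v ψ = R.quadF ω q v (c • ψ) := rfl

/-- *"The interaction and observables are scaled and written as 𝒫_{k+1,loc}(Λ₈^{(k)}) …"* — the interaction slot of the scaled table is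
`𝒫^L_{k+1,loc}(Λ₈^{(k)})` of (5.14.5) read at `ψ^L = cψ¹` (*"Propagators and vertices appear scaled to the L⁻¹η lattice"*: the (2.12) convention
inside the slot). [cite: BalabanImbrieJaffe1988, (5.15.3) p.313] -/
theorem scaledTable_Ploc : (scaledTable c E' R).Ploc ω q v ψ = R.Ploc ω q v (c • ψ) := rfl

/-- *"The interaction and observables are scaled and written as … F_{k+1,loc}(X_{σ′}), respectively"* — the observable slot of the scaled table is
`Π_{σ′}F^L_{k+1,loc}(X_{σ′})` of (5.15.2) read at `ψ^L = cψ¹`. [cite: BalabanImbrieJaffe1988, (5.15.3) p.313] -/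
theorem scaledTable_obs : (scaledTable c E' R).obs ω q v ψ = R.obs ω q v (c • ψ) := rfl

/-- *"The scaled form of the normalization factors is given in (4.6), (4.9)"* — the `Z`-slot of the scaled table is the slot
`Π_{j=0}^{k}[Z^{(j)}Z^{(j)}(u_{k+1})]` read at `ψ^L = cψ¹` (its `k`-independence under the (2.12) rescaling of the precisions is r18's
`BIJ88Eq47Scaling` / `BIJ88Eq411Scaling`, rows C2.Eq4.7 / C2.Eq4.11). [cite: BalabanImbrieJaffe1988, (5.15.3) p.313] -/
theorem scaledTable_zf : (scaledTable c E' R).zf ω q v ψ = R.zf ω q v (c • ψ) := rfl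

/-- The new small-field characteristic function `χ_{k+1,Λ₀^{(k)′}}` ((4.5) at `k+1`) read at `ψ^L = cψ¹`. [cite: BalabanImbrieJaffe1988, (5.15.3) p.313] -/
theorem scaledTable_chi : (scaledTable c E' R).chi ω q v ψ = R.chi ω q v (c • ψ) := rfl

/-- The hole functionals `Π_{ω′}g_{k+1}(X_{ω′})` ((5.15.4)) read at `ψ^L = cψ¹`. [cite: BalabanImbrieJaffe1988, (5.15.4) p.314] -/
theorem scaledTable_holeF : (scaledTable c E' R).holeF ω q v ψ = R.holeF ω q v (c • ψ) := rfl

/-- **`ℰ_{k+1} = (ℰ_k + E^{(k)}) + E′`** — the normalizing-energy slot of the scaled table is the old one plus the Jacobian exponent `E′`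
(*"Thus we define the (k+1)th normalizing energy to be ℰ_{k+1} = ℰ_k + E^{(k)} + …(log L)|T₁^{(k+1)}|"*; honest `E′ = (d−2)(log L)|T₁^{(k+1)}|`
for the printed `c`, `jacExponent_printed`). [cite: BalabanImbrieJaffe1988, (5.15.3) p.313] -/
theorem scaledTable_calE : (scaledTable c E' R).calE ω q v ψ = R.calE ω q v (c • ψ) + E' := rfl

/-- kernel: a positive Jacobian written as `exp(−E′)` merges into the exponential of the table. [cite: BalabanImbrieJaffe1988, (5.15.3) p.313] -/
theorem exp_jac_mul_exp (E' A : ℝ) :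
    ((Real.exp (-E') : ℝ) : ℂ) * ((Real.exp (-A) : ℝ) : ℂ) = ((Real.exp (-(A + E')) : ℝ) : ℂ) := by
  rw [← Complex.ofReal_mul, ← Real.exp_add]
  congr 1
  ring_nf

/-- **THE JACOBIAN ABSORBED INTO THE NORMALIZING ENERGY, SLOT BY SLOT**: `c^N·ρ′_{k+1}[R](q, v, cψ¹) = ρ′_{k+1}[scaledTable c E′ R](q, v, ψ¹)`
with `E′ = −N log c` (`c > 0`; `ρ′_{k+1}` = p34's transcription `rhoPrime313`: `χ·Πg·ΠF·Π[ZZ]·exp[−½quadF − ½quadPsi − 𝒫 − ℰ]`).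
[cite: BalabanImbrieJaffe1988, (5.15.3) p.313] -/
theorem rhoPrime313_scaled {c : ℝ} (hc : 0 < c) (R : Result313 P k Ω) (ω : Ω) (q : Cfg P k) (v : GaugeField P (k+1) U1)
    (ψ : HiggsField P (k+1)) :
    ((c ^ dimPsi P k : ℝ) : ℂ) * rhoPrime313 R ω q v (c • ψ) =
      rhoPrime313 (scaledTable c (-(dimPsi P k * Real.log c)) R) ω q v ψ := by
  rw [jac_eq_exp hc (dimPsi P k)]
  simp only [rhoPrime313, scaledTable]
  set E' : ℝ := -(↑(dimPsi P k) * Real.log c) with hE'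
  have key := exp_jac_mul_exp E'
    (R.quadF ω q v (c • ψ) / 2 + R.quadPsi ω q v (c • ψ) / 2 + R.Ploc ω q v (c • ψ) + R.calE ω q v (c • ψ))
  have hassoc : R.quadF ω q v (c • ψ) / 2 + R.quadPsi ω q v (c • ψ) / 2 + R.Ploc ω q v (c • ψ) + R.calE ω q v (c • ψ) + E' =
      R.quadF ω q v (c • ψ) / 2 + R.quadPsi ω q v (c • ψ) / 2 + R.Ploc ω q v (c • ψ) + (R.calE ω q v (c • ψ) + E') := by ring
  rw [hassoc] at key
  rw [← key]
  ring

end Table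

/-! ## §3 The RESULT display after the scaling -/

section Result

variable {ι Ω : Type*} {holes : Finset Ω} {fam : Ω → Finset ι} {Λ : ι → Finset (PBond P (k+1))}
variable {Qu : GaugeField P k U1 → GaugeField P (k+1) U1} {D : ι → Interior P k} {hole : ι → Ω}
variable {ρL : GaugeField P (k+1) U1 → HiggsField P (k+1) → ℂ}

/-- **THE RESULT pp. 313–314 AFTER THE SCALING (5.15.3), AT MEASURE LEVEL (PROVED)**: if `ρ^L_{k+1}` IS the RESULT display with the transcribed
integrand `ρ′_{k+1}[R]` (p34's `IsResult313 R`), then `ρ_{k+1} := 𝒮_cρ^L_{k+1}` (r16/p34's `scaleStep c`, honest Jacobian `c^N`, `N = 2|T₁^{(k+1)}|`) IS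
the RESULT display with the integrand `ρ′_{k+1}[scaledTable c (−N log c) R]` — the slots read at `ψ^L = cψ¹`, the Jacobian inside `ℰ_{k+1}` — *"which
is in the form of our original induction hypothesis, (4.1)"*; every `c > 0`. [cite: BalabanImbrieJaffe1988, (5.15.4) p.314] -/
theorem isResult313_scaleStep {c : ℝ} (hc : 0 < c) (R : Result313 P k Ω) (h : IsResult313 R holes fam Λ Qu D hole ρL) :
    IsResult313 (scaledTable c (-(dimPsi P k * Real.log c)) R) holes fam Λ Qu D hole (scaleStep c ρL) :=
  isResult313_of_isR41T _ hole (isR41T_scaleStep hc ((isResult313_iff R holes fam Λ Qu D hole ρL).1 h))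
    fun _ _ s _ q v ψ => rhoPrime313_scaled hc R (hole s) q v ψ

/-- **THE PRINTED INSTANCE** — `c = L^{−(d−2)/2}` (*"putting ψ^L(y) = L^{−(d−2)/2}ψ¹(L⁻¹y)"*): the RESULT display for `ρ_{k+1} = 𝒮ρ^L_{k+1}` with the
slots read at `ψ^L = L^{−(d−2)/2}ψ¹` and the normalizing energy `ℰ_{k+1} = (ℰ_k + E^{(k)}) + E0prime d L |T₁^{(k+1)}|`, `E0prime d L n = (d−2)(log L)·n`
(r18's (3.42); the honest increment, G-C2-10). [cite: BalabanImbrieJaffe1988, (5.15.3) p.313] -/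
theorem isResult313_scaleStep_printed {L : ℝ} (hL : 0 < L) (R : Result313 P k Ω) (h : IsResult313 R holes fam Λ Qu D hole ρL) :
    IsResult313 (scaledTable (L ^ (-(((P.d : ℝ) - 2) / 2))) (E0prime P.d L (Fintype.card (Balaban1983to89.Site P (k+1)))) R)
      holes fam Λ Qu D hole (scaleStep (L ^ (-(((P.d : ℝ) - 2) / 2))) ρL) := by
  have hc : 0 < L ^ (-(((P.d : ℝ) - 2) / 2)) := Real.rpow_pos_of_pos hL _
  have hE : -((dimPsi P k : ℕ) * Real.log (L ^ (-(((P.d : ℝ) - 2) / 2)))) =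
      E0prime P.d L (Fintype.card (Balaban1983to89.Site P (k+1))) := by
    rw [dimPsi_eq]
    exact jacExponent_printed hL P.d _
  rw [← hE]
  exact isResult313_scaleStep hc R h

/-- kernel: the scaled RESULT density has the total integral of `ρ^L_{k+1}` (r16/p34's `integral_integral_scaleStep`), so the normalization chain
`∫dvdψ ρ_{k+1} = ∫dvdψ ρ^L_{k+1} = [F]` of (5.1.3)/(3.13) is kept through the scaling. [cite: BalabanImbrieJaffe1988, (5.15.3) p.313] -/
theorem integral_result_scaleStep_printed {L : ℝ} (hL : 0 < L) (ρL : GaugeField P (k+1) U1 → HiggsField P (k+1) → ℂ) :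
    ∫ v, ∫ ψ, scaleStep (L ^ (-(((P.d : ℝ) - 2) / 2))) ρL v ψ ∂volume ∂fieldMeasure P (k+1) U1 =
      ∫ v, ∫ ψ, ρL v ψ ∂volume ∂fieldMeasure P (k+1) U1 :=
  integral_integral_scaleStep (Real.rpow_pos_of_pos hL _) ρL

end Result

/-! ## §4 *"The quadratic forms become …"*: the forms of the rescaled field are the forms of the rescaled operators -/

section Forms

variable {M : Type*} [NormedAddCommGroup M] [InnerProductSpace ℝ M]

/-- **«The quadratic forms become … ½⟨Λ₈^{(k)′}ψ, Δ_{k+1,loc}(u_{k+1})Λ₈^{(k)′}ψ⟩»**, the `ψ`-form: for a quadratic slot given by a real-linear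
reading `S` of the block scalar field (restriction to `Λ₈^{(k)′}` composed with the real coordinates) and an operator `A` (`Δ^L_{k+1,loc}(u_{k+1})`)
on a real inner-product space, the form of the scaled field is the form of the RESCALED operator: `⟨S(cψ¹), A S(cψ¹)⟩ = ⟨Sψ¹, (c²A)Sψ¹⟩` — with
`c = L^{−(d−2)/2}`, `c²A = L^{−(d−2)}Δ^L_{k+1,loc}(u_{k+1})`, the operator the (2.12) convention names `Δ_{k+1,loc}(u_{k+1})` on `T₁^{(k+1)}`.
[cite: BalabanImbrieJaffe1988, (5.15.3) p.313] -/
theorem quadForm_scale (S : HiggsField P (k+1) →ₗ[ℝ] M) (A : M →ₗ[ℝ] M) (c : ℝ) (ψ : HiggsField P (k+1)) :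
    ⟪S (c • ψ), A (S (c • ψ))⟫ = ⟪S ψ, (c ^ 2 • A) (S ψ)⟫ := by
  rw [map_smul, map_smul, LinearMap.smul_apply, real_inner_smul_left, real_inner_smul_right, real_inner_smul_right]
  ring

/-- **«The quadratic forms become ½⟨Λ₅^{(k)′**}f^{(k+1)}, σ_{k+1,loc}Λ₅^{(k)′**}f^{(k+1)}⟩ …»**, the `f`-form: a RENAMING — with `f = r·f^{(k+1)}`
(`r = e_{k+1}/e_k`, i.e. `e_kf = e_{k+1}f^{(k+1)}`: *"Defining f^{(k+1)}(p) = (ie_{k+1})⁻¹ log v(p)"*, this seat's gen-9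
`BIJ88Scaling313Background.fieldStrength_units`) a bilinear slot `B` (`σ^L_{k+1,loc}` sandwiched by `Λ₅^{(k)′**}`) satisfies `B(f, f) =
(r²B)(f^{(k+1)}, f^{(k+1)})` — the same number, written with the operator `r²σ^L_{k+1,loc}` that the (2.12) convention names `σ_{k+1,loc}`.
[cite: BalabanImbrieJaffe1988, (5.15.3) p.313] -/
theorem quadForm_renaming {V : Type*} [AddCommGroup V] [Module ℝ V] (B : V →ₗ[ℝ] V →ₗ[ℝ] ℝ) (r : ℝ) (f' : V) :
    B (r • f') (r • f') = (r ^ 2 • B) f' f' := by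
  rw [map_smul, LinearMap.smul_apply, map_smul, LinearMap.smul_apply, LinearMap.smul_apply, smul_eq_mul, smul_eq_mul, smul_eq_mul]
  ring

/-- kernel: the two renamings compose — reading the `ψ`-form at `cψ¹` AND writing it with the rescaled operator is one identity of real numbers:
for a bilinear slot `B`, `B(cψ¹, cψ¹) = (c²B)(ψ¹, ψ¹)` (the bilinear version of `quadForm_scale`, no inner product needed).
[cite: BalabanImbrieJaffe1988, (5.15.3) p.313] -/
theorem quadForm_scale_bilin (B : HiggsField P (k+1) →ₗ[ℝ] HiggsField P (k+1) →ₗ[ℝ] ℝ) (c : ℝ) (ψ : HiggsField P (k+1)) :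
    B (c • ψ) (c • ψ) = (c ^ 2 • B) ψ ψ :=
  quadForm_renaming B c ψ

/-- **The `ψ`-form slot of the scaled table written with the rescaled operator**: if before the scaling the slot is a bilinear form `B_{ω,q,v}` of
`ψ^L` (`⟨Λ₈^{(k)′}ψ^L, Δ^L_{k+1,loc}(u_{k+1})Λ₈^{(k)′}ψ^L⟩`), then after the scaling it is the bilinear form `c²B_{ω,q,v}` of `ψ¹` — *"The quadratic
forms become … ½⟨Λ₈^{(k)′}ψ, Δ_{k+1,loc}(u_{k+1})Λ₈^{(k)′}ψ⟩"* with `Δ_{k+1,loc}(u_{k+1})` the rescaled operator. [cite: BalabanImbrieJaffe1988, (5.15.3) p.313] -/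
theorem scaledTable_quadPsi_of_bilin {Ω : Type*} (c E' : ℝ) (R : Result313 P k Ω)
    (B : Ω → Cfg P k → GaugeField P (k+1) U1 → HiggsField P (k+1) →ₗ[ℝ] HiggsField P (k+1) →ₗ[ℝ] ℝ)
    (hB : ∀ ω q v ψ, R.quadPsi ω q v ψ = B ω q v ψ ψ) (ω : Ω) (q : Cfg P k) (v : GaugeField P (k+1) U1) (ψ : HiggsField P (k+1)) :
    (scaledTable c E' R).quadPsi ω q v ψ = (c ^ 2 • B ω q v) ψ ψ := by
  rw [scaledTable_quadPsi, hB, quadForm_scale_bilin]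

end Forms

/-! ## §5 The scaling on FUNCTION identities: `𝒮` respects `dv dψ`-a.e. equality -/

section AE

/-- kernel: the substitution map `(v, ψ¹) ↦ (v, cψ¹)` pushes `dv dψ` to the multiple `|c^{−N}|·dv dψ` of itself (`c ≠ 0`; Lebesgue measure on
`ℂ^{T}` under a homothety, Mathlib's `Measure.map_addHaar_smul`; the computation inside r16/p34's `BIJ88RTIterated.integrable_scaleStep`, made a
lemma). [cite: BalabanImbrieJaffe1988, (5.15.3) p.313] -/
theorem map_prod_smul_psi {c : ℝ} (hc : c ≠ 0) :
    ((fieldMeasure P (k+1) U1).prod (volume : Measure (HiggsField P (k+1)))).map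
        (fun z : GaugeField P (k+1) U1 × HiggsField P (k+1) => (z.1, c • z.2)) =
      ENNReal.ofReal |(c ^ dimPsi P k)⁻¹| • (fieldMeasure P (k+1) U1).prod volume := by
  have h1 : (fun z : GaugeField P (k+1) U1 × HiggsField P (k+1) => (z.1, c • z.2)) =
      Prod.map id (fun ψ : HiggsField P (k+1) => c • ψ) := rfl
  rw [h1, ← Measure.map_prod_map _ _ measurable_id (measurable_const_smul c), Measure.map_id,
    Measure.map_addHaar_smul volume hc, Measure.prod_smul_right]

/-- kernel: hence the substitution map is quasi-measure-preserving for `dv dψ`. [cite: BalabanImbrieJaffe1988, (5.15.3) p.313] -/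
theorem quasiMeasurePreserving_smul_psi {c : ℝ} (hc : c ≠ 0) :
    QuasiMeasurePreserving (fun z : GaugeField P (k+1) U1 × HiggsField P (k+1) => (z.1, c • z.2))
      ((fieldMeasure P (k+1) U1).prod volume) ((fieldMeasure P (k+1) U1).prod volume) := by
  refine ⟨measurable_fst.prodMk ((measurable_const_smul c).comp measurable_snd), ?_⟩
  rw [map_prod_smul_psi hc]
  exact Measure.smul_absolutelyContinuous

/-- **The scaling passes to function identities**: if `ρ^L_{k+1} = F` `dv dψ`-a.e. (p34's RESULT as a FUNCTION identity over r18's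
`prevMeasure P (k+1)`, `BIJ88Eq596FibreIntegral.result41_ae_eq`, or any other a.e. description of the density), then `𝒮_cρ^L_{k+1} = 𝒮_cF`
`dv dψ¹`-a.e. — so *"ρ(v, ψ¹) = … ρ^L(v, L^{−(d−2)/2}ψ¹)"* may be read on any a.e. representative. [cite: BalabanImbrieJaffe1988, (5.15.3) p.313] -/
theorem scaleStep_congr_ae {c : ℝ} (hc : c ≠ 0) {ρL ρL' : GaugeField P (k+1) U1 → HiggsField P (k+1) → ℂ}
    (h : uncurry ρL =ᵐ[(fieldMeasure P (k+1) U1).prod volume] uncurry ρL') :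
    uncurry (scaleStep c ρL) =ᵐ[(fieldMeasure P (k+1) U1).prod volume] uncurry (scaleStep c ρL') := by
  filter_upwards [(quasiMeasurePreserving_smul_psi (P := P) (k := k) hc).ae_eq_comp h] with z hz
  simp only [Function.comp_apply, uncurry] at hz
  simp only [uncurry, scaleStep, hz]

end AE

/-! ## §6 (v1.1) *"The quadratic forms become …"* in the kernel vocabulary of the induction hypothesis (4.1)

r18's `BIJ88InductiveForm41.Term41` carries the two forms of (4.1) as KERNEL sums: `gaugeForm T u = Σ_{p,p′∈Λ₅} f(p)σ(p,p′)f(p′)` with the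
real field strength `fStrength T.ek u p` at the running charge, and `scalarForm T u_k φ = Re Σ_{x,y∈Λ₈} φ̄(x)Δ(u_k;x,y)φ(y)`.  The p. 313 sentence
*"The quadratic forms become ½⟨Λ₅^{(k)′**}f^{(k+1)}, σ_{k+1,loc}Λ₅^{(k)′**}f^{(k+1)}⟩ + ½⟨Λ₈^{(k)′}ψ, Δ_{k+1,loc}(u_{k+1})Λ₈^{(k)′}ψ⟩"* in this vocabulary:
the gauge form at charge `e_k` with kernel `σ^L_{k+1,loc}` IS the gauge form at charge `e_{k+1}` with the kernel `(e_{k+1}/e_k)²σ^L_{k+1,loc}`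
(*"Defining f^{(k+1)}(p) = (ie_{k+1})⁻¹ log v(p)"*, `e_kf = e_{k+1}f^{(k+1)}`), and the scalar form at `ψ^L = cψ¹` with kernel `Δ^L_{k+1,loc}(u_{k+1})`
IS the scalar form at `ψ¹` with kernel `c²Δ^L_{k+1,loc}(u_{k+1})` — the kernels that the (2.12) convention names `σ_{k+1,loc}`, `Δ_{k+1,loc}(u_{k+1})`
are `Term41` kernels at level `k+1`. -/

section KernelForms

open BIJ88InductiveForm41 (Term41 fStrength gaugeForm scalarForm)
open BIJ88Scaling313Background (fieldStrength_units)

variable {j : ℕ}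

/-- **«Defining f^{(k+1)}(p) = (ie_{k+1})⁻¹ log v(p)»** for the REAL field strength of r18's (4.1): `e·f_e(u;p) = e′·f_{e′}(u;p)` (real part of
this seat's gen-9 `fieldStrength_units`; `e, e′ ≠ 0`). [cite: BalabanImbrieJaffe1988, (5.15.3) p.313] -/
theorem fStrength_units {e e' : ℝ} (he : e ≠ 0) (he' : e' ≠ 0) (u : PBond P j → ℂ) (p : Balaban1983to89.Plaq P j) :
    e * fStrength e u p = e' * fStrength e' u p := by
  have h := congrArg Complex.re (fieldStrength_units he he' (BIJ88Sect3Statements.plaqVar u p))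
  simpa only [fStrength, Complex.re_ofReal_mul] using h

/-- kernel: `f_e = (e′/e)·f_{e′}`, i.e. `f = (e_{k+1}/e_k)·f^{(k+1)}`. [cite: BalabanImbrieJaffe1988, (5.15.3) p.313] -/
theorem fStrength_rescale {e e' : ℝ} (he : e ≠ 0) (he' : e' ≠ 0) (u : PBond P j → ℂ) (p : Balaban1983to89.Plaq P j) :
    fStrength e u p = e' / e * fStrength e' u p := by
  have h := fStrength_units he he' u p
  field_simp
  linarith

/-- **«½⟨Λ₅^{(k)′**}f, σ^L_{k+1,loc}Λ₅^{(k)′**}f⟩» = «½⟨Λ₅^{(k)′**}f^{(k+1)}, σ_{k+1,loc}Λ₅^{(k)′**}f^{(k+1)}⟩» IN r18's (4.1) VOCABULARY**: the gauge form of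
a `Term41` at charge `T.ek = e_k` with kernel `T.σloc = σ^L` equals the gauge form of the `Term41` with charge `e′ = e_{k+1}` and kernel
`(e′/e_k)²·σ^L` (everything else unchanged) — the renamed kernel is the one (2.12) names `σ_{k+1,loc}`. [cite: BalabanImbrieJaffe1988, (5.15.3) p.313] -/
theorem gaugeForm_rescale (T : Term41 P j) {e' : ℝ} (hek : T.ek ≠ 0) (he' : e' ≠ 0) (u : PBond P j → ℂ) :
    gaugeForm T u = gaugeForm { T with ek := e', σloc := fun p p' => (e' / T.ek) ^ 2 * T.σloc p p' } u := by
  simp only [gaugeForm]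
  refine Finset.sum_congr rfl fun p _ => Finset.sum_congr rfl fun p' _ => ?_
  rw [fStrength_rescale hek he' u p, fStrength_rescale hek he' u p']
  ring

/-- **«½⟨Λ₈^{(k)′}ψ, Δ^L_{k+1,loc}(u_{k+1})Λ₈^{(k)′}ψ⟩» at `ψ^L = cψ¹` = «½⟨Λ₈^{(k)′}ψ¹, Δ_{k+1,loc}(u_{k+1})Λ₈^{(k)′}ψ¹⟩» IN r18's (4.1) VOCABULARY**:
the scalar form of a `Term41` with kernel `T.Δloc = Δ^L` at the field `cψ¹` (`c` real) equals the scalar form at `ψ¹` of the `Term41` with the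
kernel `c²·Δ^L` — the rescaled kernel is the one (2.12) names `Δ_{k+1,loc}(u_{k+1})`. [cite: BalabanImbrieJaffe1988, (5.15.3) p.313] -/
theorem scalarForm_rescale (T : Term41 P j) (c : ℝ) (ukf : PBond P 0 → ℂ) (ψ : Balaban1983to89.Site P j → ℂ) :
    scalarForm T ukf (c • ψ) = scalarForm { T with Δloc := fun w x y => ((c ^ 2 : ℝ) : ℂ) * T.Δloc w x y } ukf ψ := by
  simp only [scalarForm, Pi.smul_apply, Complex.real_smul, map_mul, Complex.conj_ofReal]
  congr 1
  refine Finset.sum_congr rfl fun x _ => Finset.sum_congr rfl fun y _ => ?_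
  push_cast
  ring

/-- Hence for the SLOTS: if before the scaling the `ψ`-form slot of p34's table is the (4.1) scalar form of `Term41` data (kernel `Δ^L`), then
after the scaling (`scaledTable`) it is the (4.1) scalar form of `Term41` data at `k+1` with the kernel `c²Δ^L`.
[cite: BalabanImbrieJaffe1988, (5.15.3) p.313] -/
theorem scaledTable_quadPsi_term41 {Ω : Type*} (c E' : ℝ) (R : Result313 P k Ω) (T : Ω → Cfg P k → GaugeField P (k+1) U1 → Term41 P (k+1))
    (uk : Ω → Cfg P k → GaugeField P (k+1) U1 → (PBond P 0 → ℂ))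
    (hR : ∀ ω q v ψ, R.quadPsi ω q v ψ = scalarForm (T ω q v) (uk ω q v) ψ) (ω : Ω) (q : Cfg P k) (v : GaugeField P (k+1) U1)
    (ψ : HiggsField P (k+1)) :
    (scaledTable c E' R).quadPsi ω q v ψ =
      scalarForm { T ω q v with Δloc := fun w x y => ((c ^ 2 : ℝ) : ℂ) * (T ω q v).Δloc w x y } (uk ω q v) ψ := by
  rw [scaledTable_quadPsi, hR, scalarForm_rescale]

/-- … and if the `f`-form slot is the (4.1) gauge form of `Term41` data at charge `e_k` (kernel `σ^L`, the block gauge field read as the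
unit-lattice gauge field of level `k+1` by `uOf`), then it is the (4.1) gauge form at charge `e_{k+1}` with kernel `(e_{k+1}/e_k)²σ^L` — before and
after the scaling alike (the scaling does not touch `v`). [cite: BalabanImbrieJaffe1988, (5.15.3) p.313] -/
theorem scaledTable_quadF_term41 {Ω : Type*} (c E' : ℝ) (R : Result313 P k Ω) (T : Ω → Cfg P k → Term41 P (k+1))
    (uOf : GaugeField P (k+1) U1 → (PBond P (k+1) → ℂ)) {ek1 : ℝ} (hek : ∀ ω q, (T ω q).ek ≠ 0) (hek1 : ek1 ≠ 0)
    (hR : ∀ ω q v ψ, R.quadF ω q v ψ = gaugeForm (T ω q) (uOf v)) (ω : Ω) (q : Cfg P k) (v : GaugeField P (k+1) U1)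
    (ψ : HiggsField P (k+1)) :
    (scaledTable c E' R).quadF ω q v ψ =
      gaugeForm { T ω q with ek := ek1, σloc := fun p p' => (ek1 / (T ω q).ek) ^ 2 * (T ω q).σloc p p' } (uOf v) := by
  rw [scaledTable_quadF, hR, gaugeForm_rescale (T ω q) (hek ω q) hek1]

end KernelForms

end

end Literature.MathematicalPhysics.QuantumFieldTheory.BalabanImbrieJaffe1984to88.BIJ88Scaling313Result
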